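import Summits.AtomisticToContinuum.Crystallization.Theorems.OverbindingBudgetEnergyTubeBox

/-!
# OverbindingBudget · decomp-a2c lens-4 g34 — part XXII-J: NUM in CERTIFICATE SHAPE (critic row 501 (e)) — finitely many spans + an analytic tail

Helper file under `--supports stmt-AtomisticToContinuum-31280` (RDEF = `Theses.OverbindingBudget.RobustDefectLimitWindows`); closes nothing.

The configuration-free numerical leaves NUM-T `StraightCellEnergyT Λ₁ η₁ η₂ s₁ s₂ e` and SQX `SquareCellsExtinct Λ₁ η₁ η₂ e` (parts XXII-F/H) ask,
for every admissible (un)pinned cell and every band height `h`, `StraightBound a b n h e`: `e ≤ φ₀/2 + Σ'_{s ∈ ℕ} layerField a b (v s)` for every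
sequence of inter-layer offsets `v s` at heights `(s+1)·h` — an INFINITE sum.  The census certifies FINITELY many spans; the rest is the attractive
Lennard-Jones tail of far layers, an analytic matter.  This file types the cut
* FIN-T `StraightCellEnergyFinT Λ₁ η₁ η₂ s₁ s₂ s₀ e` / FIN-S `SquareCellsExtinctFin Λ₁ η₁ η₂ s₀ e` [CERT·M]: the same binders, conclusion
  `e ≤ φ₀/2 + Σ_{s < s₀} layerField a b (v s)` — a bound on `1 + s₀` two-dimensional lateral minimisations per (cell, height), exactly the census«s
  TAG 183 computation (`K_iso ≈ 27`, `K_dev ≈ 12` boxes per cell parameter);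
* TAIL `LayerFieldTailSum Λ₁ η₁ η₂ s₀ ε` [ANALYTIC·S]: for every admissible cell, band height and offset sequence, `s ↦ layerField a b (v s)` is summable
  and the far spans `s ≥ s₀` contribute at least `−ε` (LJ ≥ its attractive part, smeared over the layer lattice at height `≥ (s₀+1)·η₁`: `ε ≍ C/(η₁⁴ s₀³)`;
  lens-3«s `ChartedPlanarOrderLatticeSmear` is the tool);
proves the seams NUM-T(e) ⟸ FIN-T(s₀; e + ε) ∧ TAIL(s₀; ε) and SQX(e) ⟸ FIN-S(s₀; e + ε) ∧ TAIL(s₀; ε) (`Summable.sum_add_tsum_nat_add`), the ★ seam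
`stackedCellPinningU_of_finCert`, and the cone of record candidate XXXI `rdef_thirtyfirst_of_recordK_finCert_ref (s₁ s₂ h₀ κ′ s₀ ε)` (= XXX_ref of
part XXII-I with NUM-T/SQX so cut; level bookkeeping: ★ at `e⋆ + κ′`, E2 at `e⋆ + κ′`, NUM/SQX at `e⋆ + 2κ′`, FIN at `e⋆ + 2κ′ + ε`).
-/

noncomputable section

namespace Summit.AtomisticToContinuum.Crystallization.Theorems.OverbindingBudgetEnergyFinCert

open Metric Finset
open scoped RealInnerProductSpace
open Literature.MathematicalPhysics.StatisticalMechanics (lennardJones groundStateEnergy)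
open Summit.AtomisticToContinuum.Crystallization.Theses.OverbindingBudget (RobustDefectLimitWindows)
open Summit.AtomisticToContinuum.Crystallization.Theses.PricedLinkCensus (ChargedEnergyGap)
open Summit.AtomisticToContinuum.Crystallization.Theorems.ChargedEnergyGapNegative (eStar)
open Summit.AtomisticToContinuum.Crystallization.Theorems.OverbindingBudgetGradedBareness (CleanlessExcessT)
open Summit.AtomisticToContinuum.Crystallization.Theorems.OverbindingBudgetCoherentCut (CoherentResidual)
open Summit.AtomisticToContinuum.Crystallization.Theorems.OverbindingBudgetUniformCutStatements (GrossCleanBallsU)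
open Summit.AtomisticToContinuum.Crystallization.Theorems.OverbindingBudgetElasticSplitScale (CompressedVirialLaw)
open Summit.AtomisticToContinuum.Crystallization.Theorems.OverbindingBudgetElasticSplitShear (StressFree)
open Summit.AtomisticToContinuum.Crystallization.Theorems.ChartedPlanarOrderChunkFloor (E3)
open Summit.AtomisticToContinuum.Crystallization.Theorems.ChartedPlanarOrderRigidityDoor (IsNash)
open Summit.AtomisticToContinuum.Crystallization.Theorems.ChartedPlanarOrderDensityDichotomy (μS IsSep)
open Summit.AtomisticToContinuum.Crystallization.Theorems.ChartedPlanarOrderDoorLayered (Layered)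
open Summit.AtomisticToContinuum.Crystallization.Theorems.ChartedPlanarOrderProfileSlavingLJ (IsStacked gapStress incr)
open Summit.AtomisticToContinuum.Crystallization.Theorems.OverbindingBudgetScaleWidening (IsCleanW DoorPeriodicW)
open Summit.AtomisticToContinuum.Crystallization.Theorems.OverbindingBudgetTwoShellShape (TwoShellShape BarlowGluingW)
open Summit.AtomisticToContinuum.Crystallization.Theorems.OverbindingBudgetStackedRigidityW (StackedReductionW GapStressVanishesW)
open Summit.AtomisticToContinuum.Crystallization.Theorems.OverbindingBudgetRegistryCut (IsUnitNormal Pinned RegistryLocalisationW RegistryResidual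
  RegistryTube RegistryZeroExists zeroExists_of_residual_tube)
open Summit.AtomisticToContinuum.Crystallization.Theorems.OverbindingBudgetRegistrySquare (PinnedSq)
open Summit.AtomisticToContinuum.Crystallization.Theorems.OverbindingBudgetRegistryDichotomy (IsTType IsSType RegistryGeometryW BalancedLocus
  registryLocalisationW_of_geometry_locus sqRegistryLocalisationW_of_geometry_height)
open Summit.AtomisticToContinuum.Crystallization.Theorems.OverbindingBudgetRegistryDichotomyCW (RegistryMetricCW)
open Summit.AtomisticToContinuum.Crystallization.Theorems.OverbindingBudgetEnergyPinning (StackedCellPinningU)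
open Summit.AtomisticToContinuum.Crystallization.Theorems.OverbindingBudgetEnergyStraightening (layerField StraightBound StraightenedFloor
  StraightCellEnergyT StraightCellEnergyS)
open Summit.AtomisticToContinuum.Crystallization.Theorems.OverbindingBudgetEnergySquareExtinction (SquareCellsExtinct stackedCellPinningU_of_sqExtinct
  sqRegistryGeometryW_empty sqBalancedHeight_empty sqRegistryMetricCW_empty)
open Summit.AtomisticToContinuum.Crystallization.Theorems.OverbindingBudgetEnergyTubeBox (RegistryPinningP TubeConvexRefP
  rdef_of_grossU_shape_gluing_pinningU_convexRefP_registry)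

/-! ## §1 The pieces -/

/-- **FIN-T · `StraightCellEnergyFinT Λ₁ η₁ η₂ s₁ s₂ s₀ e`** [CERT·M, configuration-free, FINITE]: NUM-T«s binders verbatim; for every sequence of
inter-layer offsets `v s` at heights `(s+1)·h` the level `e` lies below `φ₀(a,b)/2 + Σ_{s < s₀} layerField a b (v s)` — the in-plane half energy plus the
first `s₀` spans only.  Why it might fail: numerically only — at `e = e⋆ + 2κ′ + ε` the unpinned-T margin (`≈ 2.3·10⁻⁴` at half-width `0.5 %`, E183) must
exceed the dropped tail `ε` plus the interval-certification width. [piece] -/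
def StraightCellEnergyFinT (Λ₁ η₁ η₂ s₁ s₂ : ℝ) (s₀ : ℕ) (e : ℝ) : Prop :=
  ∀ (a b n : E3), LinearIndependent ℝ ![a, b] → ‖a‖ ≤ Λ₁ → ‖b‖ ≤ Λ₁ →
    (∀ i j : ℤ, ((i : ℝ) • a + (j : ℝ) • b) ≠ 0 → 9 / 10 ≤ ‖(i : ℝ) • a + (j : ℝ) • b‖) → IsUnitNormal a b n → IsTType a b →
    ¬ Pinned s₁ s₂ a b → ∀ h : ℝ, η₁ ≤ h → h ≤ η₂ → ∀ v : ℕ → E3, (∀ s : ℕ, ⟪v s, n⟫ = ((s : ℝ) + 1) * h) →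
      e ≤ layerField a b 0 / 2 + ∑ s ∈ range s₀, layerField a b (v s)

/-- **FIN-S · `SquareCellsExtinctFin Λ₁ η₁ η₂ s₀ e`** [CERT·M, configuration-free, FINITE]: SQX«s binders verbatim, first `s₀` spans only.  Why it might
fail: numerically only — the square-branch margin `≈ 6·10⁻⁵ − 2κ′` must exceed `ε` plus the certification width. [piece] -/
def SquareCellsExtinctFin (Λ₁ η₁ η₂ : ℝ) (s₀ : ℕ) (e : ℝ) : Prop :=
  ∀ (a b n : E3), LinearIndependent ℝ ![a, b] → ‖a‖ ≤ Λ₁ → ‖b‖ ≤ Λ₁ →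
    (∀ i j : ℤ, ((i : ℝ) • a + (j : ℝ) • b) ≠ 0 → 9 / 10 ≤ ‖(i : ℝ) • a + (j : ℝ) • b‖) → IsUnitNormal a b n → IsSType a b →
    ∀ h : ℝ, η₁ ≤ h → h ≤ η₂ → ∀ v : ℕ → E3, (∀ s : ℕ, ⟪v s, n⟫ = ((s : ℝ) + 1) * h) →
      e ≤ layerField a b 0 / 2 + ∑ s ∈ range s₀, layerField a b (v s)

/-- **TAIL · `LayerFieldTailSum Λ₁ η₁ η₂ s₀ ε`** [ANALYTIC·S]: for every admissible cell (either type, pinned or not), unit normal, band height `h` and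
offset sequence at heights `(s+1)·h`, the span energies `s ↦ layerField a b (v s)` are SUMMABLE and the far spans `s ≥ s₀` contribute at least `−ε`.
Why it might fail: only if `ε` is set below the true LJ tail `≍ C/(η₁⁴ s₀³)` of the admissible cells (smear constant of the coarsest cell, area
`≥ (9/10)²·sin 60°`). [piece] -/
def LayerFieldTailSum (Λ₁ η₁ η₂ : ℝ) (s₀ : ℕ) (ε : ℝ) : Prop :=
  ∀ (a b n : E3), LinearIndependent ℝ ![a, b] → ‖a‖ ≤ Λ₁ → ‖b‖ ≤ Λ₁ →
    (∀ i j : ℤ, ((i : ℝ) • a + (j : ℝ) • b) ≠ 0 → 9 / 10 ≤ ‖(i : ℝ) • a + (j : ℝ) • b‖) → IsUnitNormal a b n →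
    ∀ h : ℝ, η₁ ≤ h → h ≤ η₂ → ∀ v : ℕ → E3, (∀ s : ℕ, ⟪v s, n⟫ = ((s : ℝ) + 1) * h) →
      Summable (fun s : ℕ => layerField a b (v s)) ∧ -ε ≤ ∑' s : ℕ, layerField a b (v (s + s₀))

/-! ## §2 Seams (PROVED): NUM-T ⟸ FIN-T ∧ TAIL, SQX ⟸ FIN-S ∧ TAIL, ★ ⟸ STR ∧ FIN-T ∧ FIN-S ∧ TAIL -/

/-- the head + tail split of the straightened energy. [bookkeeping] -/
theorem straightBound_of_fin_tail {a b n : E3} {h e ε : ℝ} {s₀ : ℕ}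
    (hfin : ∀ v : ℕ → E3, (∀ s : ℕ, ⟪v s, n⟫ = ((s : ℝ) + 1) * h) → e + ε ≤ layerField a b 0 / 2 + ∑ s ∈ range s₀, layerField a b (v s))
    (htail : ∀ v : ℕ → E3, (∀ s : ℕ, ⟪v s, n⟫ = ((s : ℝ) + 1) * h) →
      Summable (fun s : ℕ => layerField a b (v s)) ∧ -ε ≤ ∑' s : ℕ, layerField a b (v (s + s₀))) :
    StraightBound a b n h e := by
  intro v hv
  obtain ⟨hsum, ht⟩ := htail v hv
  have hf := hfin v hv
  rw [← hsum.sum_add_tsum_nat_add s₀]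
  linarith

/-- **NUM-T ⟸ FIN-T ∧ TAIL.** [this file] -/
theorem straightCellEnergyT_of_fin {Λ₁ η₁ η₂ s₁ s₂ e ε : ℝ} {s₀ : ℕ} (hF : StraightCellEnergyFinT Λ₁ η₁ η₂ s₁ s₂ s₀ (e + ε))
    (hT : LayerFieldTailSum Λ₁ η₁ η₂ s₀ ε) : StraightCellEnergyT Λ₁ η₁ η₂ s₁ s₂ e :=
  fun a b n hab ha hb hlat hn hTT hp h h₁ h₂ =>
    straightBound_of_fin_tail (fun v hv => hF a b n hab ha hb hlat hn hTT hp h h₁ h₂ v hv) (fun v hv => hT a b n hab ha hb hlat hn h h₁ h₂ v hv)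

/-- **SQX ⟸ FIN-S ∧ TAIL.** [this file] -/
theorem squareCellsExtinct_of_fin {Λ₁ η₁ η₂ e ε : ℝ} {s₀ : ℕ} (hF : SquareCellsExtinctFin Λ₁ η₁ η₂ s₀ (e + ε))
    (hT : LayerFieldTailSum Λ₁ η₁ η₂ s₀ ε) : SquareCellsExtinct Λ₁ η₁ η₂ e :=
  fun a b n hab ha hb hlat hn hSS h h₁ h₂ =>
    straightBound_of_fin_tail (fun v hv => hF a b n hab ha hb hlat hn hSS h h₁ h₂ v hv) (fun v hv => hT a b n hab ha hb hlat hn h h₁ h₂ v hv)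

/-- a larger tail allowance / a lower level is weaker. [bookkeeping] -/
theorem layerFieldTailSum_mono {Λ₁ η₁ η₂ ε ε' : ℝ} {s₀ : ℕ} (h : LayerFieldTailSum Λ₁ η₁ η₂ s₀ ε) (hε : ε ≤ ε') :
    LayerFieldTailSum Λ₁ η₁ η₂ s₀ ε' :=
  fun a b n hab ha hb hlat hn hh h₁ h₂ v hv =>
    ⟨(h a b n hab ha hb hlat hn hh h₁ h₂ v hv).1, by linarith [(h a b n hab ha hb hlat hn hh h₁ h₂ v hv).2]⟩

/-- ★ **`StackedCellPinningU Λ₁ s₁ s₂ 1 0 ⟸ STR ∧ TAIL(s₀; ε) ∧ FIN-T(s₀; e⋆ + 2κ′ + ε) ∧ FIN-S(s₀; e⋆ + 2κ′ + ε)`** (square branch extinct). [this file] -/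
theorem stackedCellPinningU_of_finCert {Λ₁ s₁ s₂ κ' ε : ℝ} {s₀ : ℕ} (hκ' : 0 < κ') (hΛ₁ : Λ₁ ≤ 17 / 16) (hSTR : StraightenedFloor Λ₁)
    (hTail : LayerFieldTailSum Λ₁ (3 / 8) (23 / 20) s₀ ε) (hFT : StraightCellEnergyFinT Λ₁ (3 / 8) (23 / 20) s₁ s₂ s₀ (eStar + 2 * κ' + ε))
    (hFS : SquareCellsExtinctFin Λ₁ (3 / 8) (23 / 20) s₀ (eStar + 2 * κ' + ε)) : StackedCellPinningU Λ₁ s₁ s₂ 1 0 :=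
  stackedCellPinningU_of_sqExtinct hκ' hΛ₁ hSTR (straightCellEnergyT_of_fin hFT hTail) (squareCellsExtinct_of_fin hFS hTail)

/-! ## §3 Cone -/

/-- ★ **RDEF cone, THIRTY-FIRST form at the numbers of record, reference-centred (proposed CURRENCY OF RECORD): ENERGY PINNING with NUM in CERTIFICATE
SHAPE, square branch extinct, tube leaves over the T-box** — cone XXX_ref of part XXII-I with NUM-T/SQX := FIN-T/FIN-S at `e⋆ + 2κ′ + ε` over `s₀`
spans + TAIL(`s₀; ε`).  Open leaves (20 + `0 < κ′`): slots 1–6, 7a, 7b, 7c″P, 7c‴P, STR, TAIL, FIN-T, FIN-S, R3geo, `BalancedLocus`, R1, R2, R5⁺, 8, 9;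
literals `s₁ s₂ h₀ κ′ s₀ ε` SYMBOLIC (census TAG 183-bis fixes them). [this file] -/
theorem rdef_thirtyfirst_of_recordK_finCert_ref (s₁ s₂ h₀ κ' : ℝ) (s₀ : ℕ) (ε : ℝ) (hκ' : 0 < κ') (hG : GrossCleanBallsU (1 / 250) 10)
    (hCEG : ChargedEnergyGap) (hC : CompressedVirialLaw (1 / 250) 10) (hS : TwoShellShape (1 / 100) (3 / 50) (1 / 450)) (hB₂ : BarlowGluingW)
    (hD : DoorPeriodicW 2) (hSR : StackedReductionW 2 (17 / 16)) (hV : GapStressVanishesW (17 / 16))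
    (hP : RegistryPinningP (17 / 16) (1 / 40) (3 / 16) s₁ s₂ 1 0) (hT : TubeConvexRefP (17 / 16) (1 / 40) s₁ s₂ 1 0)
    (hSTR : StraightenedFloor (17 / 16)) (hTail : LayerFieldTailSum (17 / 16) (3 / 8) (23 / 20) s₀ ε)
    (hFT : StraightCellEnergyFinT (17 / 16) (3 / 8) (23 / 20) s₁ s₂ s₀ (eStar + 2 * κ' + ε))
    (hFS : SquareCellsExtinctFin (17 / 16) (3 / 8) (23 / 20) s₀ (eStar + 2 * κ' + ε)) (hGeo : RegistryGeometryW (17 / 16) s₁ s₂ h₀ (3 / 20))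
    (hBal : BalancedLocus s₁ s₂ h₀ (1 / 40)) (hR1 : RegistryResidual s₁ s₂ (1 / 250)) (hR2 : RegistryTube s₁ s₂ (1 / 100) 1)
    (hMet : RegistryMetricCW s₁ s₂ (3 / 500)) (hCE : CleanlessExcessT) (hRes : CoherentResidual 10) : RobustDefectLimitWindows :=
  rdef_of_grossU_shape_gluing_pinningU_convexRefP_registry 2 (17 / 16) (1 / 40) (3 / 16) s₁ s₂ 1 0 (7 / 40) (3 / 500) 0 (1 / 100) (4 / 25) 0
    (by norm_num) (by norm_num) le_rfl (by norm_num) hG hCEG hC hS hB₂ hD hSR hV hP hT (stackedCellPinningU_of_finCert hκ' le_rfl hSTR hTail hFT hFS)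
    (registryLocalisationW_of_geometry_locus (by norm_num) hGeo hBal)
    (zeroExists_of_residual_tube (by norm_num) (by norm_num) (by norm_num) (by norm_num) (by norm_num) (by norm_num) hR1 hR2) hMet
    (sqRegistryLocalisationW_of_geometry_height (by norm_num) (sqRegistryGeometryW_empty (17 / 16) 0 (3 / 20)) (sqBalancedHeight_empty 0 (1 / 100)))
    (sqRegistryMetricCW_empty 0 (1 / 100) 0) hCE hRes

end Summit.AtomisticToContinuum.Crystallization.Theorems.OverbindingBudgetEnergyFinCert

end
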